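import Literature.MathematicalPhysics.QuantumLattice.PeierlsAssignmentChessboardBound
import Literature.Probability.LatticeModels.TorusContourCounting
import HarnessLib

/-!
# The Peierls–chessboard two-point bound on the 2-torus, uniformly in the volume
# (Fröhlich–Lieb 1978, Thm. 1.1 + Cor. 1.2 + (1.44))

Topic `MathematicalPhysics/QuantumLattice`. This file closes the reflection-positivity Peierls
argument of Fröhlich–Lieb (*Phase transitions in anisotropic lattice spin systems*, §I.C–I.D) on
the torus `(ℤ/Nbℤ)²`: `PeierlsAssignmentChessboardBound.peierls_chessboard_bound_of_assignment_theta`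
(FL (1.30) + (1.44): `Re⟨Pₘ⁺Pₙ⁻⟩ ≤ Σ_{γ ∈ 𝒢} θ^{|γ|}`, `θ = κ^{(b-1)/b⁵}`, for any compatible
contour assignment) is fed the assignment of FL Definition 1 made precise on the torus —
`c ↦ A(c) :=` the complement of the component of `n` in the complement of the `+` cluster of `m`
(a separating set: `m ∈ A(c) ∌ n`, both sides connected, `c = +` on the inner and `-` on the outer
endpoints of `∂A(c)`) — and the volume-uniform contour count
`TorusContourCounting.sum_pow_card_cutKeys_le_geom` (FL Thm. 1.1 without "provided `Λ` is large
enough, depending on `m` and `n`").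

* `sepSet c` (`= A(c)`), `isSeparatingSet_sepSet`, `sepSet_compatible`;
* `keyBond`, `cutBonds A` — the cut as ordered nearest-neighbour bonds `(i ∈ A, j ∉ A)`,
  `card_cutBonds` (`= |∂A|` for `Nb ≥ 3`);
* **`peierls_chessboard_twoPoint_le_series`** — `Re⟨Pₘ⁺Pₙ⁻⟩_{β,H} ≤ Σ_{ℓ ≤ 2(Nb)²} 4ℓ(4·19⁶θ)^ℓ`;
* **`peierls_chessboard_twoPoint_le`** (FL Thm. 1.1 + Cor. 1.2 + (1.44)) — for `H` Hermitian,
  translation invariant, `-βH` reflection positive across the planes between the squares of side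
  `b` of `(ℤ/Nbℤ)²` (`N` even, `N > 1`, `Nb ≥ 3`), real single-site `0 ≤ P±` with `P⁺ + P⁻ = 1`,
  and a dipole smallness bound `Re⟨P_Λ(p)⟩ ≤ κ^{N²}` (`0 < κ ≤ 1`):
  `Re⟨Pₘ⁺Pₙ⁻⟩_{β,H} ≤ 4ρ/(1-ρ)²`, `ρ = 4·19⁶·κ^{(b-1)/b⁵} < 1`, for all `m ≠ n`, UNIFORMLY in `N`;
* `heisAnisoReal_twoPoint_le` — the hypotheses on `H` discharged for the rotated antiferromagnet
  with direction-dependent couplings `K ≥ 0` (every spin, every `β ≥ 0`).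

What is NOT here: the smallness of `κ` itself (FL §III, "principle of exponential localization")
and the thermodynamic estimate (1.17); with those, (1.11)–(1.24) give long-range order.
No named facts; no sorries.

## References

* J. Fröhlich, E. H. Lieb, *Phase transitions in anisotropic lattice spin systems*, Comm. Math.
  Phys. **60** (1978) 233–267, §I.C Definition 1, Thm. 1.1, Cor. 1.2, eqs. (1.26)–(1.33), §I.D
  (1.44)–(1.45). [FrohlichLieb1978]
* Á. Timár, Proc. Amer. Math. Soc. **141** (2013) 475–480, Lemma 1. [Timar2012]
-/

noncomputable section

open Matrix Finset NormedSpace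
open scoped Kronecker ComplexOrder MatrixOrder BigOperators
open Literature.MathematicalPhysics.QuantumLattice Literature.Probability.LatticeModels
  Literature.Barriers.CriticalPhenomena.NonGibbs Literature.Combinatorics.Enumerative

namespace Literature.MathematicalPhysics.QuantumLattice

/-! ### The separating set of a configuration -/

section SepSet

variable {L : ℕ} [NeZero L]

/-- The component of `n` in the complement of the `+` cluster of `m` (FL's `Λ_n(γ(c))`).
[cite: FrohlichLieb1978, §I.C Definition 1] -/
abbrev minusComponent (c : TorusSite 2 L → Bool) (m n : TorusSite 2 L) : Finset (TorusSite 2 L) :=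
  plusCluster (torusGraph 2 L) (fun j => !decide (j ∈ plusCluster (torusGraph 2 L) c m)) n

/-- **The separating set `A(c)`** of a configuration: the complement of `minusComponent`
(FL's `Λ_m(γ(c))`: the `+` cluster of `m` with all its holes other than the one containing `n`
filled in). [cite: FrohlichLieb1978, §I.C Definition 1] -/
def sepSet (c : TorusSite 2 L → Bool) (m n : TorusSite 2 L) : Finset (TorusSite 2 L) :=
  (minusComponent c m n)ᶜ

/-- Membership in `sepSet`. [cite: FrohlichLieb1978, §I.C Definition 1] -/
theorem mem_sepSet {c : TorusSite 2 L → Bool} {m n y : TorusSite 2 L} :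
    y ∈ sepSet c m n ↔ y ∉ minusComponent c m n := mem_compl

/-- Sites of `minusComponent` lie outside the `+` cluster of `m`.
[cite: FrohlichLieb1978, §I.C Definition 1] -/
theorem not_mem_plusCluster_of_mem_minusComponent {c : TorusSite 2 L → Bool} {m n x : TorusSite 2 L}
    (hn : c n = false) (hm : c m = true) (hx : x ∈ minusComponent c m n) :
    x ∉ plusCluster (torusGraph 2 L) c m := by
  have hn' : (fun j => !decide (j ∈ plusCluster (torusGraph 2 L) c m)) n = true := by
    simp only [Bool.not_eq_true', decide_eq_false_iff_not]
    intro h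
    have := eq_true_of_mem_plusCluster hm h
    rw [hn] at this
    exact Bool.noConfusion this
  have := eq_true_of_mem_plusCluster (G := torusGraph 2 L)
    (c := fun j => !decide (j ∈ plusCluster (torusGraph 2 L) c m)) (m := n) hn' hx
  simpa using this

/-- The `+` cluster of `m` lies in `A(c)`. [cite: FrohlichLieb1978, §I.C Definition 1] -/
theorem plusCluster_subset_sepSet {c : TorusSite 2 L → Bool} {m n : TorusSite 2 L} (hm : c m = true)
    (hn : c n = false) : plusCluster (torusGraph 2 L) c m ⊆ sepSet c m n := fun _ hx =>
  mem_sepSet.2 fun h => not_mem_plusCluster_of_mem_minusComponent hn hm h hx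

/-- A site outside `minusComponent` adjacent to it lies in the `+` cluster of `m`.
[cite: FrohlichLieb1978, §I.C Definition 1] -/
theorem mem_plusCluster_of_adj_minusComponent {c : TorusSite 2 L → Bool} {m n u v : TorusSite 2 L}
    (hu : u ∉ minusComponent c m n) (hv : v ∈ minusComponent c m n) (huv : (torusGraph 2 L).Adj u v) :
    u ∈ plusCluster (torusGraph 2 L) c m := by
  by_contra h
  exact hu (mem_plusCluster_of_adj hv huv.symm (by simpa using h))

omit [NeZero L] in
/-- The torus graph is connected: every site is reached from every other by unit steps.
[cite: FriedliVelenik2017, §3.1] -/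
theorem torusGraph_reflTransGen (hL : 1 < L) [NeZero L] (x y : TorusSite 2 L) :
    Relation.ReflTransGen (torusGraph 2 L).Adj x y := by
  have hdir : ∀ (z : TorusSite 2 L) (k : Fin 2) (a : ℕ),
      Relation.ReflTransGen (torusGraph 2 L).Adj z (z + a • Pi.single k 1) := by
    intro z k a
    induction a with
    | zero => rw [zero_nsmul, add_zero]
    | succ a ih =>
      rw [succ_nsmul, ← add_assoc]
      exact ih.tail (torusGraph_adj_add_single _ hL _ k)
  rw [eq_add_nsmul_add_nsmul x y]
  exact (hdir _ 0 _).trans (hdir _ 1 _)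

omit [NeZero L] in
/-- First entry of a path into a set `D`: a path from `f ∉ D` to `n ∈ D` has a prefix outside `D`
ending at a site adjacent to `D`. [folklore] -/
private theorem pctb_exists_first_entry {D : Finset (TorusSite 2 L)} {f n : TorusSite 2 L}
    (h : Relation.ReflTransGen (torusGraph 2 L).Adj f n) (hf : f ∉ D) (hn : n ∈ D) :
    ∃ u v, Relation.ReflTransGen (fun x y => (torusGraph 2 L).Adj x y ∧ y ∉ D) f u ∧
      (torusGraph 2 L).Adj u v ∧ u ∉ D ∧ v ∈ D := by
  induction h using Relation.ReflTransGen.head_induction_on with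
  | refl => exact absurd hn hf
  | @head f f₁ hff₁ _ ih =>
    by_cases hf₁ : f₁ ∈ D
    · exact ⟨f, f₁, Relation.ReflTransGen.refl, hff₁, hf, hf₁⟩
    · obtain ⟨u, v, hu, huv, huD, hvD⟩ := ih hf₁
      exact ⟨u, v, Relation.ReflTransGen.head ⟨hff₁, hf₁⟩ hu, huv, huD, hvD⟩

omit [NeZero L] in
/-- Reversal of a chain of steps inside a set (the adjacency is symmetric). [folklore] -/
private theorem pctb_reflTransGen_reverse {p : TorusSite 2 L → Prop} {a b : TorusSite 2 L}
    (h : Relation.ReflTransGen (fun x y => (torusGraph 2 L).Adj x y ∧ p y) a b) (ha : p a) :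
    Relation.ReflTransGen (fun x y => (torusGraph 2 L).Adj x y ∧ p y) b a := by
  induction h with
  | refl => exact Relation.ReflTransGen.refl
  | @tail x y hax hxy ih =>
    have hpx : p x := by
      induction hax with
      | refl => exact ha
      | tail _ h _ => exact h.2
    exact Relation.ReflTransGen.head ⟨hxy.1.symm, hpx⟩ ih

/-- From `m` to any site of its `+` cluster inside `A(c)`. [cite: FrohlichLieb1978, §I.C Definition 1] -/
theorem reflTransGen_sepSet_of_mem_plusCluster {c : TorusSite 2 L → Bool} {m n u : TorusSite 2 L}
    (hm : c m = true) (hn : c n = false) (hu : u ∈ plusCluster (torusGraph 2 L) c m) :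
    Relation.ReflTransGen (fun x y => (torusGraph 2 L).Adj x y ∧ y ∈ sepSet c m n) m u := by
  have h := (isPlusCluster_plusCluster (G := torusGraph 2 L) c m).2 u hu
  clear hu
  induction h with
  | refl => exact Relation.ReflTransGen.refl
  | tail _ h ih => exact ih.tail ⟨h.1, plusCluster_subset_sepSet hm hn h.2⟩

omit [NeZero L] in
/-- A chain avoiding `minusComponent` is a chain inside `A(c)`.
[cite: FrohlichLieb1978, §I.C Definition 1] -/
theorem reflTransGen_sepSet_of_avoiding [NeZero L] {c : TorusSite 2 L → Bool} {m n a b : TorusSite 2 L}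
    (h : Relation.ReflTransGen
      (fun x y => (torusGraph 2 L).Adj x y ∧ y ∉ minusComponent c m n) a b) :
    Relation.ReflTransGen (fun x y => (torusGraph 2 L).Adj x y ∧ y ∈ sepSet c m n) a b := by
  induction h with
  | refl => exact Relation.ReflTransGen.refl
  | tail _ h ih => exact ih.tail ⟨h.1, mem_sepSet.2 h.2⟩

/-- **`A(c)` is a separating set**: `m ∈ A(c)`, `n ∉ A(c)`, `A(c)` is connected from `m` and its
complement (the component of `n`) is connected from `n` (`L ≥ 2`, `c(m) = +`, `c(n) = -`).
[cite: FrohlichLieb1978, §I.C Definition 1] -/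
theorem isSeparatingSet_sepSet (hL : 1 < L) {c : TorusSite 2 L → Bool} {m n : TorusSite 2 L}
    (hm : c m = true) (hn : c n = false) : IsSeparatingSet L (sepSet c m n) m n := by
  have hmA : m ∈ sepSet c m n := plusCluster_subset_sepSet hm hn (self_mem_plusCluster c m)
  have hnD : n ∈ minusComponent c m n := self_mem_plusCluster _ n
  refine ⟨hmA, fun h => mem_sepSet.1 h hnD, fun f hf => ?_, fun b hb => ?_⟩
  · -- connectedness of `A(c)` from `m`: walk from `f` towards `n`, stop at the first entry into `D`
    have hfD : f ∉ minusComponent c m n := mem_sepSet.1 hf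
    obtain ⟨u, v, hfu, huv, huD, hvD⟩ :=
      pctb_exists_first_entry (torusGraph_reflTransGen hL f n) hfD hnD
    have huC : u ∈ plusCluster (torusGraph 2 L) c m := mem_plusCluster_of_adj_minusComponent huD hvD huv
    exact (reflTransGen_sepSet_of_mem_plusCluster hm hn huC).trans
      (reflTransGen_sepSet_of_avoiding (pctb_reflTransGen_reverse hfu hfD))
  · -- connectedness of the complement from `n`
    have hbD : b ∈ minusComponent c m n := by
      by_contra h; exact hb (mem_sepSet.2 h)
    have h := mem_plusCluster.1 hbD
    clear hb hbD
    induction h with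
    | refl => exact Relation.ReflTransGen.refl
    | @tail x y hnx hxy ih =>
      refine ih.tail ⟨hxy.1, fun h => mem_sepSet.1 h ?_⟩
      exact mem_plusCluster.2 (hnx.tail hxy)

/-- **Compatibility**: on every cut edge of `A(c)` the endpoint inside has `c = +` and the endpoint
outside has `c = -` (FL: `c(i_k) = +`, `c(j_k) = -`). [cite: FrohlichLieb1978, §I.C Definition 1] -/
theorem sepSet_compatible {c : TorusSite 2 L → Bool} {m n u v : TorusSite 2 L} (hm : c m = true)
    (hn : c n = false) (hu : u ∈ sepSet c m n) (hv : v ∉ sepSet c m n)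
    (huv : (torusGraph 2 L).Adj u v) : c u = true ∧ c v = false := by
  have hvD : v ∈ minusComponent c m n := by by_contra h; exact hv (mem_sepSet.2 h)
  have huC := mem_plusCluster_of_adj_minusComponent (mem_sepSet.1 hu) hvD huv
  refine ⟨eq_true_of_mem_plusCluster hm huC, ?_⟩
  by_contra hcv
  rw [Bool.not_eq_false] at hcv
  exact not_mem_plusCluster_of_mem_minusComponent hn hm hvD (mem_plusCluster_of_adj huC huv hcv)

end SepSet

/-! ### The cut as ordered bonds -/

section Bonds

variable {L : ℕ} [NeZero L]

/-- The ordered bond `(inside, outside)` of a cut key. [cite: FrohlichLieb1978, §I.C Definition 1] -/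
def keyBond (A : Finset (TorusSite 2 L)) (e : TorusSite 2 L × Fin 2) : TorusSite 2 L × TorusSite 2 L :=
  if e.1 ∈ A then (e.1, e.1 + Pi.single e.2 1) else (e.1 + Pi.single e.2 1, e.1)

/-- The cut of `A` as ordered nearest-neighbour bonds `(i, j)`, `i ∈ A`, `j ∉ A` (FL's contour
`γ = {⟨i_k, j_k⟩}`). [cite: FrohlichLieb1978, §I.C Definition 1] -/
def cutBonds (A : Finset (TorusSite 2 L)) : Finset (TorusSite 2 L × TorusSite 2 L) :=
  (cutKeys L A).image (keyBond A)

/-- The bonds of the cut are nearest-neighbour bonds. [cite: FrohlichLieb1978, §I.C Definition 1] -/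
theorem cutBonds_adj {A : Finset (TorusSite 2 L)} {p : TorusSite 2 L × TorusSite 2 L}
    (hp : p ∈ cutBonds A) : ∃ k : Fin 2, p.2 = p.1 + Pi.single k 1 ∨ p.1 = p.2 + Pi.single k 1 := by
  obtain ⟨e, -, rfl⟩ := mem_image.1 hp
  unfold keyBond
  split_ifs
  · exact ⟨e.2, Or.inl rfl⟩
  · exact ⟨e.2, Or.inr rfl⟩

/-- First ends inside, second ends outside. [cite: FrohlichLieb1978, §I.C Definition 1] -/
theorem mem_of_mem_cutBonds {A : Finset (TorusSite 2 L)} {p : TorusSite 2 L × TorusSite 2 L}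
    (hp : p ∈ cutBonds A) : p.1 ∈ A ∧ p.2 ∉ A := by
  obtain ⟨e, he, rfl⟩ := mem_image.1 hp
  have hcut := mem_cutKeys.1 he
  unfold keyBond
  split_ifs with h
  · exact ⟨h, fun h' => hcut ⟨fun _ => h', fun _ => h⟩⟩
  · refine ⟨?_, h⟩
    by_contra h'
    exact hcut ⟨fun h'' => absurd h'' h, fun h'' => absurd h'' h'⟩

/-- The two ends of a cut bond are adjacent (`L ≥ 2`). [cite: FrohlichLieb1978, §I.C Definition 1] -/
theorem adj_of_mem_cutBonds (hL : 1 < L) {A : Finset (TorusSite 2 L)}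
    {p : TorusSite 2 L × TorusSite 2 L} (hp : p ∈ cutBonds A) : (torusGraph 2 L).Adj p.1 p.2 := by
  obtain ⟨e, -, rfl⟩ := mem_image.1 hp
  unfold keyBond
  split_ifs
  · exact torusGraph_adj_add_single _ hL _ _
  · exact (torusGraph_adj_add_single _ hL _ _).symm

/-- The first ends and the second ends of the cut bonds are disjoint.
[cite: FrohlichLieb1978, §I.C Definition 1] -/
theorem disjoint_cutBonds (A : Finset (TorusSite 2 L)) :
    Disjoint ((cutBonds A).image Prod.fst) ((cutBonds A).image Prod.snd) := by
  rw [disjoint_left]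
  intro x hx hx'
  obtain ⟨p, hp, rfl⟩ := mem_image.1 hx
  obtain ⟨p', hp', h'⟩ := mem_image.1 hx'
  exact (mem_of_mem_cutBonds hp').2 (h' ▸ (mem_of_mem_cutBonds hp).1)

omit [NeZero L] in
/-- `e_k + e_{k'} ≠ 0` on the torus of side `L ≥ 3`. [folklore] -/
private theorem pctb_single_add_single_ne_zero (hL : 2 < L) (k k' : Fin 2) :
    (Pi.single k 1 : TorusSite 2 L) + Pi.single k' 1 ≠ 0 := by
  intro h
  have h1 := congrFun h k
  simp only [Pi.add_apply, Pi.single_eq_same, Pi.zero_apply] at h1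
  haveI : Fact (1 < L) := ⟨by omega⟩
  by_cases hk : k = k'
  · subst hk
    rw [Pi.single_eq_same] at h1
    have h2 : ((2 : ℕ) : ZMod L) = 0 := by rw [Nat.cast_two, ← one_add_one_eq_two]; exact h1
    have h3 := congrArg ZMod.val h2
    rw [ZMod.val_natCast, Nat.mod_eq_of_lt hL, ZMod.val_zero] at h3
    exact two_ne_zero h3
  · rw [Pi.single_apply, if_neg hk, add_zero] at h1
    exact one_ne_zero h1

omit [NeZero L] in
/-- `e_k` determines `k` (`L ≥ 2`). [folklore] -/
private theorem pctb_single_inj (hL : 1 < L) {k k' : Fin 2}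
    (h : (Pi.single k 1 : TorusSite 2 L) = Pi.single k' 1) : k = k' := by
  by_contra hk
  have h1 := congrFun h k
  rw [Pi.single_eq_same, Pi.single_apply, if_neg hk] at h1
  haveI : Fact (1 < L) := ⟨hL⟩
  exact one_ne_zero h1

/-- **The number of cut bonds is the number of cut keys** (`L ≥ 3`).
[cite: FrohlichLieb1978, §I.C Definition 1] -/
theorem card_cutBonds (hL : 2 < L) (A : Finset (TorusSite 2 L)) :
    (cutBonds A).card = (cutKeys L A).card := by
  refine card_image_of_injOn fun e he e' he' h => ?_
  have hc := mem_cutKeys.1 (mem_coe.1 he)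
  have hc' := mem_cutKeys.1 (mem_coe.1 he')
  unfold keyBond at h
  split_ifs at h with h1 h2 h2
  · obtain ⟨hx, hs⟩ := Prod.mk.injEq _ _ _ _ ▸ h
    rw [hx] at hs
    exact Prod.ext hx (pctb_single_inj (by omega) (add_left_cancel hs))
  · obtain ⟨hx, hs⟩ := Prod.mk.injEq _ _ _ _ ▸ h
    rw [hx, add_assoc, add_eq_left] at hs
    exact absurd hs (pctb_single_add_single_ne_zero hL _ _)
  · obtain ⟨hx, hs⟩ := Prod.mk.injEq _ _ _ _ ▸ h
    rw [hs, add_assoc, add_eq_left] at hx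
    exact absurd hx (pctb_single_add_single_ne_zero hL _ _)
  · obtain ⟨hx, hs⟩ := Prod.mk.injEq _ _ _ _ ▸ h
    rw [hs] at hx
    exact Prod.ext hs (pctb_single_inj (by omega) (add_left_cancel hx))

end Bonds

/-! ### The two-point bound, uniformly in the volume -/

section Main

variable {N b : ℕ} [NeZero N] [NeZero b] {n : ℕ}

/-- **The Peierls–chessboard two-point bound on the 2-torus as a contour series (FL Thm. 1.1 +
(1.44)).** Let `H` be Hermitian and translation invariant on `(ℤ/Nbℤ)²` (`N` even, `N > 1`,
`Nb ≥ 3`) with `-βH` reflection positive across the lines between the squares of side `b`; real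
single-site `0 ≤ P±` with `P⁺ + P⁻ = 1`; `0 < κ ≤ 1` with `Re⟨P_Λ(p)⟩ ≤ κ^{N²}` for every dipole
square pattern `p`. Then for all `m ≠ n`, with `θ = κ^{(b-1)/b⁵}`:
`Re⟨Pₘ⁺Pₙ⁻⟩_{β,H} ≤ Σ_{ℓ=0}^{2(Nb)²} 4ℓ (4·19⁶·θ)^ℓ`
(each configuration is assigned the cut of its separating set `A(c)`; `≤ 4ℓ(4·19⁶)^ℓ` of them have
length `ℓ`, independently of `N`, `m`, `n`). [cite: FrohlichLieb1978, Thm. 1.1, eqs. (1.30)–(1.33), (1.44)] -/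
theorem peierls_chessboard_twoPoint_le_series [NeZero (N * b)] (hN : Even N) (hN1 : 1 < N)
    (hL : 2 < N * b) {β : ℝ} {H : Op (TorusSite 2 (N * b)) (n + 1)} (hH : H.IsHermitian)
    (hK : ∀ (i : Fin 2) (k : ZMod N),
      IsRPExponent (N * b) i (blockPlane N b k) (hN.mul_right b) (-(β : ℂ) • H))
    (hT : ∀ v : TorusSite 2 (N * b),
      H.submatrix (fun σ => σ ∘ ⇑(Equiv.addRight v)) (fun σ => σ ∘ ⇑(Equiv.addRight v)) = H)
    {Pp Pm : Matrix (Fin (n + 1)) (Fin (n + 1)) ℂ} (hPp : Pp.PosSemidef) (hPm : Pm.PosSemidef)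
    (hsum : Pp + Pm = 1) (hPpr : Pp.map (starRingEnd ℂ) = Pp) (hPmr : Pm.map (starRingEnd ℂ) = Pm)
    {κ : ℝ} (hκ0 : 0 < κ) (hκ1 : κ ≤ 1)
    (hsmall : ∀ (v i j : TorusSite 2 (N * b)),
      (∃ k : Fin 2, j = i + Pi.single k 1 ∨ i = j + Pi.single k 1) →
      blockOf N b (i - v) = blockOf N b (j - v) →
      (Matrix.gibbsState β H (productOp fun y =>
        cubePattern hN v (selectedOp Pp Pm {i} {j}) (blockOf N b (i - v))
          (mirroredOffset hN y))).re ≤ κ ^ (N ^ 2))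
    {m n' : TorusSite 2 (N * b)} (hmn : m ≠ n') :
    (Matrix.gibbsState β H (onSite m Pp * onSite n' Pm)).re ≤
      ∑ ℓ ∈ range (2 * (N * b) ^ 2 + 1),
        (4 * ℓ : ℝ) * (4 * 19 ^ 6 * κ ^ (((b - 1 : ℕ) : ℝ) / (b : ℝ) ^ (2 * 2 + 1))) ^ ℓ := by
  classical
  have hL1 : 1 < N * b := by omega
  set θ : ℝ := κ ^ (((b - 1 : ℕ) : ℝ) / (b : ℝ) ^ (2 * 2 + 1)) with hθ
  have hθ0 : 0 ≤ θ := Real.rpow_nonneg hκ0.le _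
  set 𝒢 : Finset (Finset (TorusSite 2 (N * b))) :=
    (validConfigs m n').image fun c => sepSet c m n' with h𝒢
  -- the assignment `c ↦ A(c)` with bonds `cutBonds A(c)`
  have h1 := peierls_chessboard_bound_of_assignment_theta (d := 2) two_pos hN hN1 hH hK hT hPp hPm
    hsum hPpr hPmr hκ0 hκ1 hsmall hmn 𝒢 cutBonds
    (fun g _ e he => cutBonds_adj he) (fun g _ => disjoint_cutBonds g) (fun c => sepSet c m n')
    (fun c hc => by
      obtain ⟨hm, hn⟩ := (mem_validConfigs hmn).1 hc
      refine ⟨mem_image_of_mem _ hc, fun e he => ?_⟩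
      obtain ⟨h1, h2⟩ := mem_of_mem_cutBonds he
      exact sepSet_compatible hm hn h1 h2 (adj_of_mem_cutBonds hL1 he))
  refine h1.trans ?_
  have h2 : ∑ g ∈ 𝒢, θ ^ (cutBonds g).card = ∑ g ∈ 𝒢, θ ^ (cutKeys (N * b) g).card :=
    sum_congr rfl fun g _ => by rw [card_cutBonds hL]
  rw [h2]
  refine sum_pow_card_cutKeys_le hL1 m n' 𝒢 (fun A hA => ?_) hθ0
  obtain ⟨c, hc, rfl⟩ := mem_image.1 hA
  obtain ⟨hm, hn⟩ := (mem_validConfigs hmn).1 hc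
  exact isSeparatingSet_sepSet hL1 hm hn

/-- **Fröhlich–Lieb Thm. 1.1 + Cor. 1.2 + (1.44) on the torus: the two-point bound, uniformly in
the volume.** Under the hypotheses of `peierls_chessboard_twoPoint_le_series`, if
`ρ := 4·19⁶·κ^{(b-1)/b⁵} < 1` then for all `m ≠ n`
`Re⟨Pₘ⁺Pₙ⁻⟩_{β,H} ≤ 4ρ/(1-ρ)²`,
a bound independent of `N`, `m`, `n` which tends to `0` as `κ → 0` (`b ≥ 2`): FL's
"`⟨Pₘ⁺Pₙ⁻⟩ ≤ Σ_{l ≥ 2} 2l 3^{2l-2} e^{-2lK}` … for arbitrary `m` and `n`" without the proviso "all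
sufficiently large squares `Λ`" depending on `m, n`.
[cite: FrohlichLieb1978, Thm. 1.1, Cor. 1.2, eqs. (1.32), (1.44)] -/
theorem peierls_chessboard_twoPoint_le [NeZero (N * b)] (hN : Even N) (hN1 : 1 < N)
    (hL : 2 < N * b) {β : ℝ} {H : Op (TorusSite 2 (N * b)) (n + 1)} (hH : H.IsHermitian)
    (hK : ∀ (i : Fin 2) (k : ZMod N),
      IsRPExponent (N * b) i (blockPlane N b k) (hN.mul_right b) (-(β : ℂ) • H))
    (hT : ∀ v : TorusSite 2 (N * b),
      H.submatrix (fun σ => σ ∘ ⇑(Equiv.addRight v)) (fun σ => σ ∘ ⇑(Equiv.addRight v)) = H)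
    {Pp Pm : Matrix (Fin (n + 1)) (Fin (n + 1)) ℂ} (hPp : Pp.PosSemidef) (hPm : Pm.PosSemidef)
    (hsum : Pp + Pm = 1) (hPpr : Pp.map (starRingEnd ℂ) = Pp) (hPmr : Pm.map (starRingEnd ℂ) = Pm)
    {κ : ℝ} (hκ0 : 0 < κ) (hκ1 : κ ≤ 1)
    (hsmall : ∀ (v i j : TorusSite 2 (N * b)),
      (∃ k : Fin 2, j = i + Pi.single k 1 ∨ i = j + Pi.single k 1) →
      blockOf N b (i - v) = blockOf N b (j - v) →
      (Matrix.gibbsState β H (productOp fun y =>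
        cubePattern hN v (selectedOp Pp Pm {i} {j}) (blockOf N b (i - v))
          (mirroredOffset hN y))).re ≤ κ ^ (N ^ 2))
    (hρ : 4 * 19 ^ 6 * κ ^ (((b - 1 : ℕ) : ℝ) / (b : ℝ) ^ (2 * 2 + 1)) < 1)
    {m n' : TorusSite 2 (N * b)} (hmn : m ≠ n') :
    (Matrix.gibbsState β H (onSite m Pp * onSite n' Pm)).re ≤
      4 * (4 * 19 ^ 6 * κ ^ (((b - 1 : ℕ) : ℝ) / (b : ℝ) ^ (2 * 2 + 1))) /
        (1 - 4 * 19 ^ 6 * κ ^ (((b - 1 : ℕ) : ℝ) / (b : ℝ) ^ (2 * 2 + 1))) ^ 2 := by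
  classical
  have hL1 : 1 < N * b := by omega
  set θ : ℝ := κ ^ (((b - 1 : ℕ) : ℝ) / (b : ℝ) ^ (2 * 2 + 1)) with hθ
  have hθ0 : 0 ≤ θ := Real.rpow_nonneg hκ0.le _
  set 𝒢 : Finset (Finset (TorusSite 2 (N * b))) :=
    (validConfigs m n').image fun c => sepSet c m n' with h𝒢
  have h1 := peierls_chessboard_bound_of_assignment_theta (d := 2) two_pos hN hN1 hH hK hT hPp hPm
    hsum hPpr hPmr hκ0 hκ1 hsmall hmn 𝒢 cutBonds
    (fun g _ e he => cutBonds_adj he) (fun g _ => disjoint_cutBonds g) (fun c => sepSet c m n')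
    (fun c hc => by
      obtain ⟨hm, hn⟩ := (mem_validConfigs hmn).1 hc
      refine ⟨mem_image_of_mem _ hc, fun e he => ?_⟩
      obtain ⟨h1, h2⟩ := mem_of_mem_cutBonds he
      exact sepSet_compatible hm hn h1 h2 (adj_of_mem_cutBonds hL1 he))
  refine h1.trans ?_
  have h2 : ∑ g ∈ 𝒢, θ ^ (cutBonds g).card = ∑ g ∈ 𝒢, θ ^ (cutKeys (N * b) g).card :=
    sum_congr rfl fun g _ => by rw [card_cutBonds hL]
  rw [h2]
  refine sum_pow_card_cutKeys_le_geom hL1 m n' 𝒢 (fun A hA => ?_) hθ0 hρ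
  obtain ⟨c, hc, rfl⟩ := mem_image.1 hA
  obtain ⟨hm, hn⟩ := (mem_validConfigs hmn).1 hc
  exact isSeparatingSet_sepSet hL1 hm hn

end Main

/-! ### The antiferromagnet with direction-dependent couplings (rotated frame) -/

section Model

variable {N b : ℕ} [NeZero N] [NeZero b] (n : ℕ)

/-- **Volume-uniform Peierls–chessboard two-point bound for the rotated antiferromagnet `H♭_K`
with direction-dependent couplings `K ≥ 0` on `(ℤ/Nbℤ)²`** (`N` even, `N > 1`, `Nb ≥ 3`, every
spin, every `β ≥ 0`): Hermiticity, reflection positivity across all pairs of lines and translation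
invariance hold, so for real `0 ≤ P±`, `P⁺ + P⁻ = 1` and a dipole smallness bound
`Re⟨P_Λ(p)⟩ ≤ κ^{N²}` (`0 < κ ≤ 1`) with `ρ = 4·19⁶·κ^{(b-1)/b⁵} < 1`:
`Re⟨Pₘ⁺Pₙ⁻⟩_{β,H♭_K} ≤ 4ρ/(1-ρ)²` for all `m ≠ n`, uniformly in `N`.
[cite: FrohlichLieb1978, Thm. 1.1, Cor. 1.2, eq. (1.44), §I.A (3)] -/
theorem heisAnisoReal_twoPoint_le [NeZero (N * b)] (hN : Even N) (hN1 : 1 < N) (hL : 2 < N * b)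
    {K : Fin 2 → ℝ} (hK : ∀ i, 0 ≤ K i) {β : ℝ} (hβ : 0 ≤ β)
    {Pp Pm : Matrix (Fin (n + 1)) (Fin (n + 1)) ℂ} (hPp : Pp.PosSemidef) (hPm : Pm.PosSemidef)
    (hsum : Pp + Pm = 1) (hPpr : Pp.map (starRingEnd ℂ) = Pp) (hPmr : Pm.map (starRingEnd ℂ) = Pm)
    {κ : ℝ} (hκ0 : 0 < κ) (hκ1 : κ ≤ 1)
    (hsmall : ∀ (v i j : TorusSite 2 (N * b)),
      (∃ k : Fin 2, j = i + Pi.single k 1 ∨ i = j + Pi.single k 1) →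
      blockOf N b (i - v) = blockOf N b (j - v) →
      (Matrix.gibbsState β (heisWeightedRealFieldHamiltonian (N * b) n (dirCoupling (N * b) K) 0)
        (productOp fun y => cubePattern hN v (selectedOp Pp Pm {i} {j}) (blockOf N b (i - v))
          (mirroredOffset hN y))).re ≤ κ ^ (N ^ 2))
    (hρ : 4 * 19 ^ 6 * κ ^ (((b - 1 : ℕ) : ℝ) / (b : ℝ) ^ (2 * 2 + 1)) < 1)
    {m n' : TorusSite 2 (N * b)} (hmn : m ≠ n') :
    (Matrix.gibbsState β (heisWeightedRealFieldHamiltonian (N * b) n (dirCoupling (N * b) K) 0)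
        (onSite m Pp * onSite n' Pm)).re ≤
      4 * (4 * 19 ^ 6 * κ ^ (((b - 1 : ℕ) : ℝ) / (b : ℝ) ^ (2 * 2 + 1))) /
        (1 - 4 * 19 ^ 6 * κ ^ (((b - 1 : ℕ) : ℝ) / (b : ℝ) ^ (2 * 2 + 1))) ^ 2 :=
  peierls_chessboard_twoPoint_le hN hN1 hL
    (heisWeightedRealFieldHamiltonian_isHermitian (N * b) n _ 0)
    (fun i k => heisWeightedReal_isRPExponent (N * b) n (hN.mul_right b) (dirCoupling_nonneg _ hK)
      (fun j a e => dirCoupling_map_reflectBetweenSites (N * b) j a K e) hβ i (blockPlane N b k))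
    (heisWeightedRealFieldHamiltonian_submatrix_comp_addRight (N * b) n
      (fun u e => dirCoupling_map_addRight (N * b) K u e))
    hPp hPm hsum hPpr hPmr hκ0 hκ1 hsmall hρ hmn

end Model

end Literature.MathematicalPhysics.QuantumLattice

end
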